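import Summits.CriticalPhenomena.CardyFormulaZ2.Theorems.CardyIKTransportIKLinearTransportStubPinnedSamplerRowCFTP
import Summits.CriticalPhenomena.CardyFormulaZ2.Theorems.CardyIKTransportIKLinearTransportStubPinnedSamplerCFTP
import Summits.CriticalPhenomena.CardyFormulaZ2.Theorems.CardyIKTransportIKLinearTransportStubPinnedSamplerCFTPExact

/-!
# Stub `stub_PinnedSampler` — the coding step discharged: `stub_PinnedSampler` reduced to (A_dyn) alone

Theorem-only support file (`--supports stmt-CriticalPhenomena-5076`, registered sub-goal
`pinnedSampler_of_uniformRowCFTP`). Reads the landed coding theorem `ps2_pinnedSampler_of_rowCFTP`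
(coupling from the past along rows ⇒ pinned sampler) through the vocabulary `IsRowCFTP` / `rowSweep` /
`pinnedStat` of `…StubPinnedSamplerRowCFTP.lean` and composes: the registered signature of
`stub_PinnedSampler` follows from (A_dyn) with constants uniform in the admissible `(S, i)`,
`∃ C c, 0 < c ∧ ∀ S i, (i ∈ S ↔ i+1 ∉ S) → StripDiagramExchange S i → ∃ Φ Coal, IsRowCFTP C c S i Φ Coal`
— the one remaining research statement of the stub (exponential coalescence in mean of the grand coupling
of the exact diagram-conditioned middle-column chain, plus local approximability of its kernels).
`isRowCFTP_of_exact_row` builds `IsRowCFTP` from the ONE-ROW exactness of the dynamics (the chain rule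
`ps2_exact_sweep_of_exact_row`), the form a construction of `Φ` from the row kernels naturally delivers.
-/

noncomputable section

namespace Summit.CriticalPhenomena.CardyFormulaZ2.Theorems.IKLinearTransport.PinnedDiagramExchange

open scoped Classical MeasureTheory ENNReal symmDiff
open Set MeasureTheory
open Literature.Probability.Percolation Literature.Probability.LatticeModels

/-- THE CODING STEP in the vocabulary `IsRowCFTP`: an exact, coalescing, quasi-local row dynamics and strip
diagram exchange give a pinned sampler with constants `(max C 0 · (2 + 4/c), c/2)`. [folklore] -/
theorem pinnedSampler_of_isRowCFTP :
    ∀ (C c : ℝ), 0 < c → ∃ C' c' : ℝ, 0 < c' ∧ ∀ (S : Set ℤ) (i : ℤ)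
      (Φ : ℤ → Obs × Set (Site 2 × Site 2) → Rnd → Obs → Obs)
      (Coal : ℤ → ℕ → Set ((Obs × Set (Site 2 × Site 2)) × Rnd)),
      IsRowCFTP C c S i Φ Coal → StripDiagramExchange S i → ∃ G : Obs → Rnd → Obs, PinnedSampler C' c' S i G := by
  intro C c hc
  obtain ⟨C', c', hc', h⟩ := ps2_pinnedSampler_of_rowCFTP C c hc
  refine ⟨C', c', hc', fun S i Φ Coal hR hX => ?_⟩
  exact h S i Φ Coal hR.measurable hR.writes_row hR.cov hR.exact hR.coal_meas hR.coal_sound hR.coal_tail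
    hR.coal_cov hR.local_approx hX

/-- `IsRowCFTP` FROM ONE-ROW EXACTNESS: if the row dynamics reads the bits of its own row only, its new
middle row depends on the start only below that row, and one row resampling from the exchanged model is
exact, the sweep exactness of `IsRowCFTP` follows (`ps2_exact_sweep_of_exact_row`); the other fields are
passed through. [folklore] -/
theorem isRowCFTP_of_exact_row (C c : ℝ) (S : Set ℤ) (i : ℤ)
    (Φ : ℤ → Obs × Set (Site 2 × Site 2) → Rnd → Obs → Obs)
    (Coal : ℤ → ℕ → Set ((Obs × Set (Site 2 × Site 2)) × Rnd))
    (hm : ∀ y, Measurable fun t : (Obs × Set (Site 2 × Site 2)) × (Rnd × Obs) => Φ y t.1 t.2.1 t.2.2)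
    (hW : ∀ y p u z, (∀ w : Site 2, w ≠ ![i + 1, y] → (w ∈ (Φ y p u z).1 ↔ w ∈ z.1)) ∧
      (∀ f : Site 2, f ≠ ![i, y] → f ≠ ![i + 1, y] → (f ∈ (Φ y p u z).2 ↔ f ∈ z.2)))
    (hcov : ∀ (y k : ℤ) (x : Obs) (u : Rnd) (z : Obs),
      Φ y (pinnedStat i (vshift k x)) (ushift k u) (vshift k z) = vshift k (Φ (y - k) (pinnedStat i x) u z))
    (hRd : ∀ (y : ℤ) (p : Obs × Set (Site 2 × Site 2)) (z : Obs) (u u' : Rnd),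
      (∀ (w : Site 2) (k : ℕ), w 1 = y → ((w, k) ∈ u ↔ (w, k) ∈ u')) → Φ y p u z = Φ y p u' z)
    (hPast : ∀ (y : ℤ) (p : Obs × Set (Site 2 × Site 2)) (u : Rnd) (z z' : Obs),
      (∀ w : Site 2, w 1 < y → (w ∈ z.1 ↔ w ∈ z'.1) ∧ (w ∈ z.2 ↔ w ∈ z'.2)) →
      (![i + 1, y] ∈ (Φ y p u z).1 ↔ ![i + 1, y] ∈ (Φ y p u z').1) ∧
      (![i, y] ∈ (Φ y p u z).2 ↔ ![i, y] ∈ (Φ y p u z').2) ∧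
      (![i + 1, y] ∈ (Φ y p u z).2 ↔ ![i + 1, y] ∈ (Φ y p u z').2))
    (hEx : ∀ (y : ℤ) (D : Set ((Obs × Set (Site 2 × Site 2)) × Obs)), MeasurableSet D →
      (∀ (p : Obs × Set (Site 2 × Site 2)) (z z' : Obs),
        ((∀ w : Site 2, (w 1 < y + 1 ∨ w 0 ≠ i + 1) → (w ∈ z.1 ↔ w ∈ z'.1)) ∧
         (∀ w : Site 2, (w 1 < y + 1 ∨ (w 0 ≠ i ∧ w 0 ≠ i + 1)) → (w ∈ z.2 ↔ w ∈ z'.2))) →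
        ((p, z) ∈ D ↔ (p, z') ∈ D)) →
      ((νmix (S ∆ {i, i + 1})).prod β) {xu | (pinnedStat i xu.1, Φ y (pinnedStat i xu.1) xu.2 xu.1) ∈ D} =
      (νmix (S ∆ {i, i + 1})) {x | (pinnedStat i x, x) ∈ D})
    (coal_meas : ∀ y m, MeasurableSet (Coal y m))
    (coal_sound : ∀ (y : ℤ) (m : ℕ) (p : Obs × Set (Site 2 × Site 2)) (u : Rnd), (p, u) ∈ Coal y m →
      ∀ z : Obs,
        (![i + 1, y] ∈ (rowSweep Φ (m + 1) (y - m) p u z).1 ↔ ![i + 1, y] ∈ (rowSweep Φ (m + 1) (y - m) p u p.1).1) ∧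
        (![i, y] ∈ (rowSweep Φ (m + 1) (y - m) p u z).2 ↔ ![i, y] ∈ (rowSweep Φ (m + 1) (y - m) p u p.1).2) ∧
        (![i + 1, y] ∈ (rowSweep Φ (m + 1) (y - m) p u z).2 ↔ ![i + 1, y] ∈ (rowSweep Φ (m + 1) (y - m) p u p.1).2))
    (coal_tail : ∀ (y : ℤ) (m : ℕ), ((νmix S).prod β) {xu | (pinnedStat i xu.1, xu.2) ∉ Coal y m} ≤
      ENNReal.ofReal (C * Real.exp (-c * m)))
    (coal_cov : ∀ (y : ℤ) (m : ℕ) (k : ℤ) (x : Obs) (u : Rnd),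
      (pinnedStat i (vshift k x), ushift k u) ∈ Coal y m ↔ (pinnedStat i x, u) ∈ Coal (y - k) m)
    (local_approx : ∀ (v : Site 2) (r : ℕ), ∃ Gfin : Obs → Rnd → Obs,
      (∀ (x x' : Obs) (u u' : Rnd),
        (∀ w ∈ ballInf v (2 * r), (w ∈ x.1 ↔ w ∈ x'.1) ∧ (w ∈ x.2 ↔ w ∈ x'.2) ∧
          ∀ k : ℕ, ((w, k) ∈ u ↔ (w, k) ∈ u')) →
        ∀ w ∈ ballInf v r, (w ∈ (Gfin x u).1 ↔ w ∈ (Gfin x' u').1) ∧ (w ∈ (Gfin x u).2 ↔ w ∈ (Gfin x' u').2)) ∧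
      ((νmix S).prod β) {xu | ∃ w ∈ ballInf v r,
        (w 0 = i + 1 ∧ ¬ (w ∈ (rowSweep Φ (r + 1) (w 1 - r) (pinnedStat i xu.1) xu.2 (eraseMid i xu.1)).1 ↔
          w ∈ (Gfin xu.1 xu.2).1)) ∨
        ((w 0 = i ∨ w 0 = i + 1) ∧ ¬ (w ∈ (rowSweep Φ (r + 1) (w 1 - r) (pinnedStat i xu.1) xu.2 (eraseMid i xu.1)).2 ↔
          w ∈ (Gfin xu.1 xu.2).2))} ≤ ENNReal.ofReal (C * Real.exp (-c * r))) :
    IsRowCFTP C c S i Φ Coal :=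
  ⟨hm, hW, hcov, (ps2_exact_sweep_of_exact_row S i Φ (rowSweep Φ) (fun _ _ _ _ _ => rfl) hm hW hRd
    hPast hEx).2, coal_meas, coal_sound, coal_tail, coal_cov, local_approx⟩

/-- `stub_PinnedSampler` REDUCED TO (A_dyn) (registered sub-goal): an exact coalescing quasi-local row
dynamics for every admissible `(S, i)`, with uniform constants, gives the registered signature of
`stub_PinnedSampler` verbatim. [folklore] -/
theorem pinnedSampler_of_uniformRowCFTP :
    (∃ C c : ℝ, 0 < c ∧ ∀ (S : Set ℤ) (i : ℤ), (i ∈ S ↔ i + 1 ∉ S) → StripDiagramExchange S i →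
      ∃ (Φ : ℤ → Obs × Set (Site 2 × Site 2) → Rnd → Obs → Obs)
        (Coal : ℤ → ℕ → Set ((Obs × Set (Site 2 × Site 2)) × Rnd)), IsRowCFTP C c S i Φ Coal) →
    ∃ C c : ℝ, 0 < c ∧ ∀ (S : Set ℤ) (i : ℤ), (i ∈ S ↔ i + 1 ∉ S) →
      ∃ G : Obs → Rnd → Obs, PinnedSampler C c S i G :=
  fun hA => pinnedSampler_of_rowCFTP hA pinnedSampler_of_isRowCFTP

end Summit.CriticalPhenomena.CardyFormulaZ2.Theorems.IKLinearTransport.PinnedDiagramExchange
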